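import Literature.MathematicalPhysics.QuantumFieldTheory.QuasiLocalGaugePerturbationCellInfluence
import Literature.MathematicalPhysics.QuantumFieldTheory.QuasiLocalGaugePerturbationKernels
import Literature.MathematicalPhysics.QuantumFieldTheory.YangMillsOS
import Literature.Probability.LatticeModels.CoarseCellMixingCounting
import HarnessLib

/-!
# Line `two-scale-lsi-handover` for the crux `RobustYangMillsHandover` (stmt-QuantumFields-8892) —
# the CLOSED stub `stub_cubeInfluence` (3b)

Checked skeleton: `Cruxes/RobustYangMillsHandover/Lines/two_scale_lsi_handover.lean` (lead reshape r1:
stubs 3a `stub_cellDobrushinDecay`, 3b `stub_cubeInfluence`, 4′ `stub_clusterDeployment`). This module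
proves 3b with its statement UNFOLDED (the skeleton's `def CubeInfluence : Prop`, verbatim), so that the
skeleton closes the stub by `exact stub_cubeInfluence`.

**Statement.** For every compact group `G` with a faithful continuous unitary matrix representation
`r`, cube scale `c ≥ 1`, KP rate `κ > 0`, weight rate `0 ≤ t < κ` and target `ε₀ > 0` there are
`βs, ηs > 0` such that for `|β| ≤ βs`, `0 ≤ η ≤ ηs`, every torus `Lt` framed by
`prodFrame Lt (2c) μ` (`(μ+1)·2c ≤ Lt < (μ+2)·2c`), every CUBE-DIAGONAL `D` (no bound needed) and every
`O` with `‖O‖_{c,κ} ≤ η` and range control, the single-cell DLR kernels `(D + O).kernel r.ρ β` admit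
influence coefficients `C y x ≥ 0` in Dobrushin's TV / oscillation form whose exponentially weighted
received sums are small: `Σ_y C y x e^{t·cdist y x} ≤ ε₀`.

**Proof.** Coupling shift (`kernel_eq_kernel_zero_add_smul_wilson`): the kernels are those of
`μ_{0, D + O'}`, `O' = O + β • wilson`, with `‖O'‖_{c,κ} ≤ η' := η + |β| C_W` (`normLE_add_smul_wilson`)
and range control (`rangeControl_add_smul_wilson`). The landed one-boundary-cell comparison
`integral_kernel_cell_le_exp_mul` gives `γ_x(g | ω) ≤ e^{2a} γ_x(g | ζ)` for `[0,1]`-valued `g` reading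
cell `x`, exteriors `ω = ζ` off cell `y`, `a = a_{yx} := 2η'10⁴e^{-κ(2·cdist y x - 2)}` (cube-diagonal `D`
drops out exactly). For `f` reading cell `x` with cell-oscillation `≤ δ`, `g = (f - f(1) + δ)/(2δ) ∈ [0,1]`,
so `|γ_x(f|ω) - γ_x(f|ζ)| = 2δ|γ_x(g|ω) - γ_x(g|ζ)| ≤ 2δ(e^{2a} - 1)`: `C y x := 2(e^{2a_{yx}} - 1)`
(`0` on the diagonal). Smallness: for `2a ≤ 1`, `e^{2a} - 1 ≤ 4a`; `a_{yx} ≤ 2η'10⁴e^{2κ}e^{-2κ·cdist}`;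
a shell count on the coarse torus (`card_filter_cdist_le`: `≤ (2R+1)^4` cells within distance `R`)
bounds `Σ_y e^{-(2κ-t)cdist y x}` by `K := Σ_R (2R+1)^4 e^{-(2κ-t)R} < ∞` (`2κ - t > 0`), so the weighted
received sums are `≤ 16·10⁴ e^{2κ} K η'`, `≤ ε₀` once `η' ≤ η'₀`; take `ηs = η'₀/2`, `βs = η'₀/(2(C_W+1))`.

Sources: H.-O. Georgii, *Gibbs Measures and Phase Transitions* (2011), Ch. 8 ((8.5), Remark 8.26);
H. Föllmer, LNM 1362 (1988), Ch. I (2.20); T. Bałaban, CMP 119 (1988) p. 261 (2.42). The bookkeeping is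
folklore over the landed engines.
-/

noncomputable section

namespace Summit.QuantumFields.QCD.Cruxes.RobustYangMillsHandover.TwoScaleLsiHandover

open Literature.MathematicalPhysics.QuantumFieldTheory Literature.MathematicalPhysics.QuantumLattice
open MeasureTheory Filter Topology
open Literature.Probability.LatticeModels (CoarseIdx cdist cdist_comm card_filter_cdist_le)

/-! ## Bookkeeping lemmas -/

/-- `e^u - 1 ≤ 2u` for `u ∈ [0, 1]` (convexity and `e - 1 ≤ 2`). [folklore] -/
private theorem exp_sub_one_le_two_mul {u : ℝ} (hu0 : 0 ≤ u) (hu1 : u ≤ 1) :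
    Real.exp u - 1 ≤ 2 * u := by
  have h := QuasiLocalGaugePerturbation.exp_mul_sub_one_le_mul (s := 1) hu0 hu1
  rw [mul_one] at h
  have he : Real.exp 1 - 1 ≤ 2 := by
    have := Real.exp_one_lt_d9
    linarith
  calc Real.exp u - 1 ≤ u * (Real.exp 1 - 1) := h
    _ ≤ u * 2 := mul_le_mul_of_nonneg_left he hu0
    _ = 2 * u := mul_comm _ _

/-- The shell majorant `R ↦ (2R+1)^d e^{-sR}` is summable for `s > 0`. [folklore] -/
private theorem summable_shell (d : ℕ) {s : ℝ} (hs : 0 < s) :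
    Summable fun R : ℕ => ((2 * R + 1 : ℕ) : ℝ) ^ d * Real.exp (-(s * R)) := by
  -- `(2R+1)^d ≤ 2^d (R+1)^d` and `(R+1)^d e^{-sR} = e^s · (R+1)^d e^{-s(R+1)}`
  have h1 : Summable fun n : ℕ => ((n : ℝ)) ^ d * Real.exp (-s * n) :=
    Real.summable_pow_mul_exp_neg_nat_mul d hs
  have h2 : Summable fun R : ℕ => (((R + 1 : ℕ) : ℝ)) ^ d * Real.exp (-s * ((R + 1 : ℕ) : ℝ)) :=
    (summable_nat_add_iff 1).mpr h1
  have h3 : Summable fun R : ℕ =>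
      (2 : ℝ) ^ d * Real.exp s * ((((R + 1 : ℕ) : ℝ)) ^ d * Real.exp (-s * ((R + 1 : ℕ) : ℝ))) :=
    h2.mul_left _
  refine Summable.of_nonneg_of_le (fun R => by positivity) (fun R => ?_) h3
  have hR : ((2 * R + 1 : ℕ) : ℝ) ≤ 2 * ((R + 1 : ℕ) : ℝ) := by push_cast; linarith
  have hpow : ((2 * R + 1 : ℕ) : ℝ) ^ d ≤ (2 : ℝ) ^ d * (((R + 1 : ℕ) : ℝ)) ^ d := by
    rw [← mul_pow]; exact pow_le_pow_left₀ (by positivity) hR d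
  have hexp : Real.exp (-(s * R)) = Real.exp s * Real.exp (-s * ((R + 1 : ℕ) : ℝ)) := by
    rw [← Real.exp_add]; congr 1; push_cast; ring
  rw [hexp]
  calc ((2 * R + 1 : ℕ) : ℝ) ^ d * (Real.exp s * Real.exp (-s * ((R + 1 : ℕ) : ℝ)))
      ≤ (2 : ℝ) ^ d * (((R + 1 : ℕ) : ℝ)) ^ d * (Real.exp s * Real.exp (-s * ((R + 1 : ℕ) : ℝ))) :=
        mul_le_mul_of_nonneg_right hpow (by positivity)
    _ = _ := by ring

/-- **Shell count on the coarse torus**: for `s > 0`, `Σ_y e^{-s·cdist y x} ≤ Σ_R (2R+1)^d e^{-sR}`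
(at most `(2R+1)^d` cells at coarse distance `R`, `card_filter_cdist_le`). [folklore] -/
private theorem sum_exp_neg_cdist_le_tsum {d : ℕ} {μc : Fin d → ℕ} {s : ℝ} (hs : 0 < s)
    (x : CoarseIdx μc) :
    ∑ y, Real.exp (-(s * cdist y x)) ≤
      ∑' R : ℕ, ((2 * R + 1 : ℕ) : ℝ) ^ d * Real.exp (-(s * R)) := by
  classical
  set B := Finset.univ.sup fun y : CoarseIdx μc => cdist y x with hB
  have hmaps : ∀ y ∈ (Finset.univ : Finset (CoarseIdx μc)), cdist y x ∈ Finset.range (B + 1) :=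
    fun y _ => Finset.mem_range.2 (Nat.lt_succ_of_le (Finset.le_sup (f := fun y => cdist y x)
      (Finset.mem_univ y)))
  rw [← Finset.sum_fiberwise_of_maps_to hmaps]
  have hfib : ∀ R ∈ Finset.range (B + 1),
      ∑ y ∈ Finset.univ.filter (fun y : CoarseIdx μc => cdist y x = R), Real.exp (-(s * cdist y x)) ≤
        ((2 * R + 1 : ℕ) : ℝ) ^ d * Real.exp (-(s * R)) := by
    intro R _
    have heq : ∑ y ∈ Finset.univ.filter (fun y : CoarseIdx μc => cdist y x = R),
        Real.exp (-(s * cdist y x)) =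
        (Finset.univ.filter (fun y : CoarseIdx μc => cdist y x = R)).card * Real.exp (-(s * R)) := by
      rw [Finset.sum_congr rfl (g := fun _ => Real.exp (-(s * R))) fun y hy => by
        rw [(Finset.mem_filter.1 hy).2], Finset.sum_const, nsmul_eq_mul]
    rw [heq]
    refine mul_le_mul_of_nonneg_right ?_ (Real.exp_pos _).le
    have hsub : Finset.univ.filter (fun y : CoarseIdx μc => cdist y x = R) ⊆
        Finset.univ.filter (fun y : CoarseIdx μc => cdist x y ≤ R) := fun y hy => by
      rw [Finset.mem_filter] at hy ⊢
      exact ⟨hy.1, by rw [cdist_comm]; exact hy.2.le⟩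
    exact_mod_cast (Finset.card_le_card hsub).trans (card_filter_cdist_le x R)
  refine (Finset.sum_le_sum hfib).trans ?_
  exact (summable_shell d hs).sum_le_tsum _ fun R _ => by positivity

/-- Cell-oscillation control: if `f` reads only the cell `x` and moves by at most `δ` when only the cell
`x` is changed, then `|f U - f U'| ≤ δ` for ALL `U, U'`. [folklore] -/
private theorem abs_sub_le_of_cellOsc {E G ι : Type*} {cell : E → ι} {x : ι} {f : (E → G) → ℝ}
    {δ : ℝ} (hdep : DependsOn f {e | cell e = x})
    (hosc : ∀ U U' : E → G, (∀ e, cell e ≠ x → U e = U' e) → |f U - f U'| ≤ δ) (U U' : E → G) :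
    |f U - f U'| ≤ δ := by
  classical
  -- go through the hybrid configuration `U'' = U'` on cell `x`, `= U` elsewhere
  let U'' : E → G := fun e => if cell e = x then U' e else U e
  have h1 : |f U - f U''| ≤ δ := hosc U U'' fun e he => by simp [U'', he]
  have h2 : f U'' = f U' := hdep fun e he => by
    simp only [Set.mem_setOf_eq] at he
    simp [U'', he]
  rwa [h2] at h1

/-! ## The stub -/

/-- **`stub_cubeInfluence` (3b, CLOSED)** — the one-boundary-cell influence coefficients of the single-cell
DLR kernels of `μ_{β, D+O}` through the cells of `prodFrame Lt (2c) μ`, in Dobrushin's TV / oscillation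
form, with exponentially weighted received sums `≤ ε₀` for `|β| ≤ βs`, `‖O‖_{c,κ} ≤ ηs` (range controlled)
and ANY cube-diagonal `D`: `C y x = 2(e^{2a_{yx}} - 1)`, `a_{yx} = 2η'10⁴e^{-κ(2cdist y x - 2)}`,
`η' = η + |β|C_W`, via the coupling shift and the landed comparison `integral_kernel_cell_le_exp_mul`; the
weighted sums by `e^{2a} - 1 ≤ 4a` and the shell count `Σ_y e^{-(2κ-t)cdist} ≤ Σ_R (2R+1)⁴e^{-(2κ-t)R}`.
[cite: Georgii2011, Ch. 8 (8.5) and Remark 8.26] [cite: Balaban1988Convergent, p. 261 (2.42)] -/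
theorem stub_cubeInfluence :
  ∀ (G : Type) [Group G] [TopologicalSpace G] [IsTopologicalGroup G] [CompactSpace G]
      [MeasurableSpace G] [BorelSpace G], ∀ (r : LatticeRep G) (c : ℕ) (κ t ε₀ : ℝ),
    0 < c → 0 < κ → 0 ≤ t → t < κ → 0 < ε₀ →
    ∃ βs : ℝ, 0 < βs ∧ ∃ ηs : ℝ, 0 < ηs ∧ ∀ (β η : ℝ), |β| ≤ βs → 0 ≤ η → η ≤ ηs →
      ∀ (Lt μ : ℕ) [NeZero Lt], (μ + 1) * (2 * c) ≤ Lt → Lt < (μ + 2) * (2 * c) →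
      ∀ (D O : QuasiLocalGaugePerturbation 4 Lt G c),
        (∀ X : Finset (Site 4 Lt), X.card ≠ 1 → ∀ V : GaugeConfig 4 Lt G, D.act X V = 0) →
        O.NormLE κ η →
        (∀ X : Finset (Site 4 Lt), X ∈ polymers c → (∃ U : GaugeConfig 4 Lt G, O.act X U ≠ 0) →
          ∀ y ∈ X, ∀ y' ∈ X, ∀ i : Fin 4, (y i - y' i).val ≤ c * X.card ∨ (y' i - y i).val ≤ c * X.card) →
        ∃ C : Literature.Probability.LatticeModels.CoarseIdx (fun _ : Fin 4 => μ) →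
            Literature.Probability.LatticeModels.CoarseIdx (fun _ : Fin 4 => μ) → ℝ,
          (∀ y x, 0 ≤ C y x) ∧
          (∀ x y, y ≠ x → ∀ (ω ζ : GaugeConfig 4 Lt G),
            (∀ e, cellOf (prodFrame Lt (2 * c) μ) e ≠ y → ω e = ζ e) →
            ∀ (f : GaugeConfig 4 Lt G → ℝ) (δ : ℝ), Measurable f → (∃ B : ℝ, ∀ U, |f U| ≤ B) →
              DependsOn f {e | cellOf (prodFrame Lt (2 * c) μ) e = x} → 0 ≤ δ →
              (∀ U U' : GaugeConfig 4 Lt G,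
                (∀ e, cellOf (prodFrame Lt (2 * c) μ) e ≠ x → U e = U' e) → |f U - f U'| ≤ δ) →
              |(∫ U, f U ∂((D + O).kernel r.ρ β
                    (Finset.univ.filter fun e => cellOf (prodFrame Lt (2 * c) μ) e = x) ω)) -
                  ∫ U, f U ∂((D + O).kernel r.ρ β
                    (Finset.univ.filter fun e => cellOf (prodFrame Lt (2 * c) μ) e = x) ζ)| ≤
                C y x * δ) ∧
          ∀ x, ∑ y, C y x * Real.exp (t * Literature.Probability.LatticeModels.cdist y x) ≤ ε₀ := by
  intro G _ _ _ _ _ _ r c κ t ε₀ hc hκ ht htκ hε₀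
  classical
  -- constants (kept opaque): the Wilson norm constant `C_W`, the shell sum `K`, the admissible `η₀`
  obtain ⟨CW, hCW⟩ : ∃ CW : ℝ, CW = 2 * r.N * Real.exp (3 * κ) * (3 * 4 ^ 2 * c ^ 4 : ℕ) := ⟨_, rfl⟩
  have hCW0 : 0 ≤ CW := by rw [hCW]; positivity
  have hs : 0 < 2 * κ - t := by linarith
  obtain ⟨K, hK⟩ : ∃ K : ℝ, K = ∑' R : ℕ, ((2 * R + 1 : ℕ) : ℝ) ^ 4 * Real.exp (-((2 * κ - t) * R)) :=
    ⟨_, rfl⟩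
  have hK1 : 1 ≤ K := by
    have h := (summable_shell 4 hs).sum_le_tsum {0} fun R _ => by positivity
    rw [Finset.sum_singleton] at h
    have h0 : ((2 * 0 + 1 : ℕ) : ℝ) ^ 4 * Real.exp (-((2 * κ - t) * ((0 : ℕ) : ℝ))) = 1 := by
      norm_num
    rw [h0, ← hK] at h
    exact h
  have hK0 : 0 < K := by linarith
  obtain ⟨A, hA⟩ : ∃ A : ℝ, A = (10 : ℝ) ^ 4 * Real.exp (2 * κ) := ⟨_, rfl⟩
  have hA0 : 0 < A := by rw [hA]; positivity
  obtain ⟨η₀, hη₀⟩ : ∃ η₀ : ℝ, η₀ = min (ε₀ / (16 * A * K)) (1 / (4 * A)) := ⟨_, rfl⟩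
  have hη₀pos : 0 < η₀ := by rw [hη₀]; exact lt_min (by positivity) (by positivity)
  have hη₀1 : η₀ ≤ ε₀ / (16 * A * K) := hη₀ ▸ min_le_left _ _
  have hη₀2 : η₀ ≤ 1 / (4 * A) := hη₀ ▸ min_le_right _ _
  refine ⟨η₀ / (2 * (CW + 1)), by positivity, η₀ / 2, by positivity, ?_⟩
  intro β η hβ hη hηs Lt μ _ h1 h2 D O hD hO hRC
  -- second countability and `T₂` of `G` from the faithful representation
  haveI : SecondCountableTopology G :=
    (r.continuous.isClosedEmbedding r.injective).isEmbedding.secondCountableTopology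
  haveI : T2Space G := (r.continuous.isClosedEmbedding r.injective).isEmbedding.t2Space
  -- the shifted perturbation `O' = O + β • wilson` and its KP bound `η' ≤ η₀`
  set O' : QuasiLocalGaugePerturbation 4 Lt G c :=
    O + β • QuasiLocalGaugePerturbation.wilson r.ρ r.continuous c with hO'def
  set η' : ℝ := η + |β| * CW with hη'
  have hO' : O'.NormLE κ η' := by
    have h := QuasiLocalGaugePerturbation.normLE_add_smul_wilson r.ρ r.continuous r.mem_unitary
      hκ.le hc O hO β
    rw [← hCW] at h
    exact h
  have hRC' := QuasiLocalGaugePerturbation.rangeControl_add_smul_wilson r.ρ r.continuous hc O hRC β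
  have hη'0 : 0 ≤ η' := by positivity
  have hη'le : η' ≤ η₀ := by
    have hb : |β| * CW ≤ η₀ / (2 * (CW + 1)) * CW := mul_le_mul_of_nonneg_right hβ hCW0
    have hc' : η₀ / (2 * (CW + 1)) * CW ≤ η₀ / 2 := by
      rw [div_mul_eq_mul_div, div_le_div_iff₀ (by positivity) (by positivity)]
      nlinarith
    linarith
  -- frame arithmetic
  have h1' : μ * (2 * c) + 2 * c ≤ Lt := by
    calc μ * (2 * c) + 2 * c = (μ + 1) * (2 * c) := by ring
      _ ≤ Lt := h1
  have h2' : Lt < μ * (2 * c) + 2 * (2 * c) := by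
    calc Lt < (μ + 2) * (2 * c) := h2
      _ = μ * (2 * c) + 2 * (2 * c) := by ring
  -- the coefficients
  let a : CoarseIdx (fun _ : Fin 4 => μ) → CoarseIdx (fun _ : Fin 4 => μ) → ℝ := fun y x =>
    2 * η' * (10 : ℝ) ^ 4 * Real.exp (-(κ * (2 * (cdist y x : ℝ) - 2)))
  have ha0 : ∀ y x, 0 ≤ a y x := fun y x => by positivity
  let C : CoarseIdx (fun _ : Fin 4 => μ) → CoarseIdx (fun _ : Fin 4 => μ) → ℝ := fun y x =>
    if y = x then 0 else 2 * (Real.exp (2 * a y x) - 1)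
  have hC0 : ∀ y x, 0 ≤ C y x := fun y x => by
    by_cases hyx : y = x
    · simp [C, hyx]
    · simp only [C, hyx, if_false]
      have : 1 ≤ Real.exp (2 * a y x) := Real.one_le_exp (by positivity)
      linarith
  -- kernel rewrite: `(D + O).kernel ρ β = (D + O').kernel ρ 0`
  have hker : (D + O).kernel r.ρ β = (D + O').kernel r.ρ 0 :=
    QuasiLocalGaugePerturbation.kernel_eq_kernel_zero_add_smul_wilson r.ρ r.continuous β D O
  -- the kernels are probability measures (DLR, Georgii Rem. 1.24)
  have hprob : ∀ (Λ : Finset (Edge 4 Lt)) (ζ : GaugeConfig 4 Lt G),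
      IsProbabilityMeasure ((D + O').kernel r.ρ 0 Λ ζ) := fun Λ ζ =>
    (QuasiLocalGaugePerturbation.isSpecification_and_isGibbsMeasure_perturbedMeasure
      r.ρ r.continuous 0 (D + O')).1.isProbability Λ ζ
  refine ⟨C, hC0, ?_, ?_⟩
  · -- the TV / oscillation form of the influence bound
    intro x y hyx ω ζ hωζ f δ hf hfB hdep hδ hosc
    simp only [C, hyx, if_false]
    rw [hker]
    set Λ := Finset.univ.filter fun e => cellOf (prodFrame Lt (2 * c) μ) e = x with hΛ
    haveI := hprob Λ ω
    haveI := hprob Λ ζ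
    -- global oscillation `≤ δ`
    have hoscU : ∀ U U' : GaugeConfig 4 Lt G, |f U - f U'| ≤ δ := abs_sub_le_of_cellOsc hdep hosc
    let U₀ : GaugeConfig 4 Lt G := fun _ => 1
    by_cases hδ0 : δ = 0
    · -- `f` is constant
      have hconst : ∀ U, f U = f U₀ := fun U => by
        have h := hoscU U U₀
        rw [hδ0, abs_nonpos_iff, sub_eq_zero] at h
        exact h
      have hI : ∀ (ν : Measure (GaugeConfig 4 Lt G)) [IsProbabilityMeasure ν], ∫ U, f U ∂ν = f U₀ :=
        fun ν _ => by
          rw [integral_congr_ae (Filter.Eventually.of_forall hconst : (fun U => f U) =ᵐ[ν] fun _ => f U₀)]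
          simp
      rw [hI, hI, sub_self, abs_zero, hδ0, mul_zero]
    · have hδpos : 0 < δ := lt_of_le_of_ne hδ (Ne.symm hδ0)
      -- the `[0,1]`-valued rescaling `g`
      let g : GaugeConfig 4 Lt G → ℝ := fun U => (f U - f U₀ + δ) / (2 * δ)
      have hg : Measurable g := (((hf.sub measurable_const).add measurable_const).div_const _)
      have hg01 : ∀ U, 0 ≤ g U ∧ g U ≤ 1 := fun U => by
        have h := hoscU U U₀
        rw [abs_le] at h
        refine ⟨div_nonneg (by linarith) (by positivity), ?_⟩
        rw [div_le_one (by positivity)]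
        linarith
      have hgdep : DependsOn g {e | cellOf (prodFrame Lt (2 * c) μ) e = x} := fun U V hUV => by
        simp only [g, hdep hUV]
      have hfg : ∀ U, f U = 2 * δ * g U + (f U₀ - δ) := fun U => by
        simp only [g]; field_simp; ring
      -- the landed one-boundary-cell comparison, both ways
      have hcmp := fun (ω' ζ' : GaugeConfig 4 Lt G)
          (h' : ∀ e, cellOf (prodFrame Lt (2 * c) μ) e ≠ y → ω' e = ζ' e) =>
        QuasiLocalGaugePerturbation.integral_kernel_cell_le_exp_mul r.ρ r.continuous hc h1' h2' D O'
          hD hκ.le hO' hRC' x y h' (a := a y x) le_rfl hg hg01 hgdep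
      have hωζ' : ∀ e, cellOf (prodFrame Lt (2 * c) μ) e ≠ y → ζ e = ω e := fun e he => (hωζ e he).symm
      have hI1 := hcmp ω ζ hωζ
      have hI2 := hcmp ζ ω hωζ'
      have hgI1 : ∫ U, g U ∂((D + O').kernel r.ρ 0 Λ ω) ≤ 1 :=
        QuasiLocalGaugePerturbation.integral_le_one_of_forall_le_one _ hg01
      have hgI2 : ∫ U, g U ∂((D + O').kernel r.ρ 0 Λ ζ) ≤ 1 :=
        QuasiLocalGaugePerturbation.integral_le_one_of_forall_le_one _ hg01
      have hgI1' : 0 ≤ ∫ U, g U ∂((D + O').kernel r.ρ 0 Λ ω) := integral_nonneg fun U => (hg01 U).1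
      have hgI2' : 0 ≤ ∫ U, g U ∂((D + O').kernel r.ρ 0 Λ ζ) := integral_nonneg fun U => (hg01 U).1
      have hE : 1 ≤ Real.exp (2 * a y x) := Real.one_le_exp (by positivity)
      have hdiff : |(∫ U, g U ∂((D + O').kernel r.ρ 0 Λ ω)) - ∫ U, g U ∂((D + O').kernel r.ρ 0 Λ ζ)| ≤
          Real.exp (2 * a y x) - 1 := by
        rw [abs_le]
        constructor
        · nlinarith
        · nlinarith
      -- integrate `f = 2δ g + const`
      have hgint : ∀ (ν : Measure (GaugeConfig 4 Lt G)) [IsProbabilityMeasure ν], Integrable g ν :=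
        fun ν _ => Integrable.of_bound hg.aestronglyMeasurable 1 (ae_of_all _ fun U => by
          rw [Real.norm_eq_abs, abs_le]; exact ⟨by linarith [(hg01 U).1], (hg01 U).2⟩)
      have hfI : ∀ (ν : Measure (GaugeConfig 4 Lt G)) [IsProbabilityMeasure ν],
          ∫ U, f U ∂ν = 2 * δ * ∫ U, g U ∂ν + (f U₀ - δ) := fun ν _ => by
        rw [integral_congr_ae (Filter.Eventually.of_forall hfg :
          (fun U => f U) =ᵐ[ν] fun U => 2 * δ * g U + (f U₀ - δ))]
        rw [integral_add ((hgint ν).const_mul _) (integrable_const _), integral_const_mul]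
        simp
      rw [hfI, hfI]
      have hrw : 2 * δ * ∫ U, g U ∂((D + O').kernel r.ρ 0 Λ ω) + (f U₀ - δ) -
          (2 * δ * ∫ U, g U ∂((D + O').kernel r.ρ 0 Λ ζ) + (f U₀ - δ)) =
          2 * δ * ((∫ U, g U ∂((D + O').kernel r.ρ 0 Λ ω)) - ∫ U, g U ∂((D + O').kernel r.ρ 0 Λ ζ)) := by
        ring
      rw [hrw, abs_mul, abs_of_nonneg (by positivity : (0 : ℝ) ≤ 2 * δ)]
      calc 2 * δ * |(∫ U, g U ∂((D + O').kernel r.ρ 0 Λ ω)) - ∫ U, g U ∂((D + O').kernel r.ρ 0 Λ ζ)|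
          ≤ 2 * δ * (Real.exp (2 * a y x) - 1) := mul_le_mul_of_nonneg_left hdiff (by positivity)
        _ = 2 * (Real.exp (2 * a y x) - 1) * δ := by ring
  · -- the exponentially weighted received sums
    intro x
    -- `C y x ≤ 8 a_{yx} ≤ 16 η' A e^{-2κ cdist}`
    have haA : ∀ y, a y x = 2 * η' * A * Real.exp (-(2 * κ * (cdist y x : ℝ))) := fun y => by
      simp only [a]
      rw [hA]
      have : Real.exp (-(κ * (2 * (cdist y x : ℝ) - 2))) =
          Real.exp (2 * κ) * Real.exp (-(2 * κ * (cdist y x : ℝ))) := by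
        rw [← Real.exp_add]; congr 1; ring
      rw [this]; ring
    have ha1 : ∀ y, 2 * a y x ≤ 1 := fun y => by
      rw [haA]
      have hexp : Real.exp (-(2 * κ * (cdist y x : ℝ))) ≤ 1 :=
        Real.exp_le_one_iff.2 (by
          have : (0 : ℝ) ≤ cdist y x := Nat.cast_nonneg _
          nlinarith)
      have h4 : η' * A ≤ 1 / 4 := by
        calc η' * A ≤ η₀ * A := mul_le_mul_of_nonneg_right hη'le hA0.le
          _ ≤ 1 / (4 * A) * A := mul_le_mul_of_nonneg_right hη₀2 hA0.le
          _ = 1 / 4 := by field_simp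
      calc 2 * (2 * η' * A * Real.exp (-(2 * κ * (cdist y x : ℝ))))
          = 4 * (η' * A) * Real.exp (-(2 * κ * (cdist y x : ℝ))) := by ring
        _ ≤ 4 * (η' * A) * 1 := mul_le_mul_of_nonneg_left hexp (by positivity)
        _ ≤ 4 * (1 / 4) * 1 := by nlinarith
        _ = 1 := by norm_num
    have hCle : ∀ y, C y x ≤ 16 * η' * A * Real.exp (-(2 * κ * (cdist y x : ℝ))) := fun y => by
      have hrhs : 0 ≤ 16 * η' * A * Real.exp (-(2 * κ * (cdist y x : ℝ))) := by positivity
      by_cases hyx : y = x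
      · simp only [C, hyx, if_true]
        rw [hyx] at hrhs
        exact hrhs
      · simp only [C, hyx, if_false]
        have h := exp_sub_one_le_two_mul (u := 2 * a y x) (by positivity) (ha1 y)
        calc 2 * (Real.exp (2 * a y x) - 1) ≤ 2 * (2 * (2 * a y x)) := by linarith
          _ = 8 * a y x := by ring
          _ = 16 * η' * A * Real.exp (-(2 * κ * (cdist y x : ℝ))) := by rw [haA]; ring
    -- sum: `Σ_y C y x e^{t cdist} ≤ 16 η' A Σ_y e^{-(2κ-t) cdist} ≤ 16 η' A K ≤ ε₀`
    have hsum : ∑ y, C y x * Real.exp (t * (cdist y x : ℝ)) ≤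
        16 * η' * A * ∑ y, Real.exp (-((2 * κ - t) * (cdist y x : ℝ))) := by
      rw [Finset.mul_sum]
      refine Finset.sum_le_sum fun y _ => ?_
      calc C y x * Real.exp (t * (cdist y x : ℝ))
          ≤ 16 * η' * A * Real.exp (-(2 * κ * (cdist y x : ℝ))) * Real.exp (t * (cdist y x : ℝ)) :=
            mul_le_mul_of_nonneg_right (hCle y) (Real.exp_pos _).le
        _ = 16 * η' * A * Real.exp (-((2 * κ - t) * (cdist y x : ℝ))) := by
            rw [mul_assoc (16 * η' * A), ← Real.exp_add]; congr 2; ring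
    have hshell := sum_exp_neg_cdist_le_tsum (d := 4) hs x
    rw [← hK] at hshell
    have hfin : η' * (16 * A * K) ≤ ε₀ := by
      have hle := hη'le.trans hη₀1
      rwa [le_div_iff₀ (by positivity : (0 : ℝ) < 16 * A * K)] at hle
    calc ∑ y, C y x * Real.exp (t * (cdist y x : ℝ))
        ≤ 16 * η' * A * ∑ y, Real.exp (-((2 * κ - t) * (cdist y x : ℝ))) := hsum
      _ ≤ 16 * η' * A * K := mul_le_mul_of_nonneg_left hshell (by positivity)
      _ = η' * (16 * A * K) := by ring
      _ ≤ ε₀ := hfin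

end Summit.QuantumFields.QCD.Cruxes.RobustYangMillsHandover.TwoScaleLsiHandover

end
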